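import Literature.Topology.FourManifolds.BandThickening
import Literature.Topology.FourManifolds.BandSumIsotopyRegular
import Mathlib.Analysis.Calculus.BumpFunction.InnerProduct
import HarnessLib

/-!
# Transporting planar diffeotopies to `𝕊³` along a thickened band (step N3 for regular band sums)

Fact seat `provefact-Literature.Topology.FourManifolds.BandData.isIsotopic_of_band_eq`; second
brick of the proof of the corrected geometric heart
`Literature.Topology.FourManifolds.BandData.exists_ambientIsotopy_of_band_eq_of_isRegular`
(`BandSumIsotopyRegular.lean`, § "Plan of the proof"). Everything here is proved; no named facts
are introduced.

Let `T : PatchThickening β δ₀ δ₁` (`BandThickening.lean`): an open smooth embedding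
`T.emb : ℝ³ ↪ 𝕊³` with `T.emb (y, 0) = β (T.param y)`, `T.param` a diffeomorphism of `ℝ²` onto an
open set between the collar squares of widths `δ₁ < δ₀`. Given a **planar diffeotopy**
`h : Diffeotopy 𝓘(ℝ, ℝ²) ℝ²` whose stages are the identity off a compact set
`C ⊆ range T.param`, and a height `z₀ > 0`, we construct a diffeotopy
`T.transport … : Diffeotopy 𝓘(ℝ, ℝ³) 𝕊³` of the sphere such that

* `transport_apply_patch`: `F_t (β x) = β (h_t x)` for `x ∈ range T.param` — on the band surface
  the ambient isotopy *is* the planar one;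
* `transport_apply_emb`, `transport_apply_of_not_mem`, `transport_apply_eq_self`: `F_t` moves a
  point of `𝕊³` only if it is `T.emb (y, z)` with `T.param y ∈ C` and `‖z‖ < z₀`; in particular
  `F` is stationary off `T.emb (param⁻¹(C) × B(0, z₀))`, a set which shrinks to `β (C)` as
  `z₀ → 0`.

Construction: pull `h` back to the plane by `param` (`PatchThickening.pull`: `param⁻¹ ∘ h_s ∘ param`,
smooth since `h_s` preserves `range param`, `mapsTo_of_support`), lift it to `ℝ³ = ℝ² × ℝ¹` with the
time over the fibre point `z` rescaled by a bump function `κ (z)` (`liftFun`: `(y, z) ↦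
(param⁻¹ h_{t κ(z)} param y, z)`, exactly as the tube twist of `KnotReparametrisation.lean`), which is a
compactly supported diffeotopy of `ℝ³` (`lift`, `exists_liftFun_eq_self`), and transport it along
the full-target chart `T.chart = T.emb⁻¹` of `𝕊³` by the tree's `Diffeotopy.chartTransport`
(`DiffeotopyTransport.lean`: extension by the identity, Hirsch (1976), Ch. 8 §1). Finally
`BandData.IsRegular.exists_patchThickening` records that regular band data admit thickenings over a
collar square strictly between `squareNhd δ` and the regularity collar (`nonempty_patchThickening`
with `δ₁ = (δ + δ₀)/2`).

## References

* M. W. Hirsch, *Differential Topology*, GTM 33, Springer (1976), Ch. 8 §1, p. 179 (an isotopy of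
  an open subset with compact support extends by the identity) and Ch. 4 §5. [HirschDT1976]

## Design notes

* Time runs over `ℝ` and `h_s` is a diffeomorphism for every real `s`, so the rescaled time
  `t κ(z)` needs no clamping (pattern of `Diffeotopy.tubeTwist`).
* `transport` is a `Diffeotopy` (jointly smooth inverse family), hence in particular an
  `AmbientIsotopy` through `Diffeotopy.toAmbientIsotopy`; the assembly step states its results for
  the latter.
* Local notation `𝔼 n`, `𝕊 n` follows the directory pattern. Nothing here uses `sorry`.
-/

open scoped Manifold ContDiff Topology RealInnerProductSpace
open Function Set Metric

noncomputable section

namespace Literature.Topology.FourManifolds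

/-- Local notation: `𝔼 n` is the model Euclidean space `EuclideanSpace ℝ (Fin n)`. -/
local notation "𝔼 " n:arg => EuclideanSpace ℝ (Fin n)

/-- Local notation: `𝕊 n` is the unit sphere in `EuclideanSpace ℝ (Fin (n + 1))`. -/
local notation "𝕊 " n:arg => (Metric.sphere (0 : EuclideanSpace ℝ (Fin (n + 1))) 1)

/-! ## Transporting planar diffeotopies to `𝕊³` along a thickening (step N3) -/

section ModelProd

/-- A map on a product of model vector spaces which is `C^n` for the product model with corners is
`C^n` in the vector-space sense (converse of `contMDiff_prod_self_of_contDiff`,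
`DiffeotopyTransport.lean`). [folklore] -/
theorem contDiff_of_contMDiff_prod_self {E F G : Type*} [NormedAddCommGroup E] [NormedSpace ℝ E]
    [NormedAddCommGroup F] [NormedSpace ℝ F] [NormedAddCommGroup G] [NormedSpace ℝ G]
    {m : WithTop ℕ∞} {g : E × F → G} (hg : ContMDiff (𝓘(ℝ, E).prod 𝓘(ℝ, F)) 𝓘(ℝ, G) m g) :
    ContDiff ℝ m g := by
  rw [← modelWithCornersSelf_prod, chartedSpaceSelf_prod] at hg
  exact contMDiff_iff_contDiff.1 hg

/-- The stages of a diffeotopy of a model vector space are jointly smooth in the vector-space sense.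
[folklore] -/
theorem Diffeotopy.contDiff_uncurry_toFun {E : Type*} [NormedAddCommGroup E] [NormedSpace ℝ E]
    (D : Diffeotopy 𝓘(ℝ, E) E) : ContDiff ℝ ∞ (uncurry D.toFun) :=
  contDiff_of_contMDiff_prod_self D.contMDiff_uncurry_toFun

/-- The inverse stages of a diffeotopy of a model vector space are jointly smooth in the
vector-space sense. [folklore] -/
theorem Diffeotopy.contDiff_uncurry_invFun {E : Type*} [NormedAddCommGroup E] [NormedSpace ℝ E]
    (D : Diffeotopy 𝓘(ℝ, E) E) : ContDiff ℝ ∞ (uncurry D.invFun) :=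
  contDiff_of_contMDiff_prod_self D.contMDiff_uncurry_invFun

end ModelProd

section Support

variable {α : Type*} {f : α → α} {C : Set α}

/-- A bijection which is the identity off a set maps that set into itself. [folklore] -/
theorem mem_of_apply_eq_self_of_not_mem (hf : Injective f) (hC : ∀ x ∉ C, f x = x) {x : α} (hx : x ∈ C) :
    f x ∈ C := by
  by_contra h
  have hfx : f x = x := hf (hC _ h)
  exact h (by rw [hfx]; exact hx)

/-- A bijection which is the identity off `C` maps every superset of `C` into itself. [folklore] -/
theorem mem_of_apply_of_subset (hf : Injective f) (hC : ∀ x ∉ C, f x = x) {S : Set α} (hCS : C ⊆ S)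
    {x : α} (hx : x ∈ S) : f x ∈ S := by
  by_cases hxC : x ∈ C
  · exact hCS (mem_of_apply_eq_self_of_not_mem hf hC hxC)
  · rwa [hC x hxC]

end Support

namespace PatchThickening

variable {β : 𝔼 2 → 𝕊 3} {δ₀ δ₁ : ℝ} (T : PatchThickening β δ₀ δ₁)

/-! ### The chart of `𝕊³` defined by a thickening -/

/-- The chart of `𝕊³` with domain the image of the thickening and target the whole model space
`ℝ³`, inverse `T.emb` (`exists_chart_of_isSmoothEmbedding`). [folklore] -/
def chart : OpenPartialHomeomorph (𝕊 3) (𝔼 3) :=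
  (exists_chart_of_isSmoothEmbedding T.isSmoothEmbedding).choose

/-- The chart has full target. [folklore] -/
theorem chart_target : T.chart.target = univ :=
  (exists_chart_of_isSmoothEmbedding T.isSmoothEmbedding).choose_spec.1

/-- The inverse of the chart is the thickening. [folklore] -/
@[simp]
theorem coe_chart_symm : ⇑T.chart.symm = T.emb :=
  (exists_chart_of_isSmoothEmbedding T.isSmoothEmbedding).choose_spec.2.1

/-- The source of the chart is the image of the thickening. [folklore] -/
theorem chart_source : T.chart.source = range T.emb :=
  (exists_chart_of_isSmoothEmbedding T.isSmoothEmbedding).choose_spec.2.2.1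

/-- The chart is smooth on its source. [folklore] -/
theorem contMDiffOn_chart : ContMDiffOn 𝓘(ℝ, 𝔼 3) 𝓘(ℝ, 𝔼 3) ∞ T.chart T.chart.source :=
  (exists_chart_of_isSmoothEmbedding T.isSmoothEmbedding).choose_spec.2.2.2

/-- The inverse of the chart is smooth. [folklore] -/
theorem contMDiff_chart_symm : ContMDiff 𝓘(ℝ, 𝔼 3) 𝓘(ℝ, 𝔼 3) ∞ T.chart.symm := by
  rw [coe_chart_symm]
  exact T.isSmoothEmbedding.contMDiff

/-! ### Pulling planar maps back by the parametrisation -/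

/-- The inverse of the parametrisation (`Function.invFun`). [folklore] -/
def paramInv : 𝔼 2 → 𝔼 2 := Function.invFun T.param

/-- `paramInv ∘ param = id`. [folklore] -/
@[simp]
theorem paramInv_param (y : 𝔼 2) : T.paramInv (T.param y) = y :=
  Function.leftInverse_invFun T.injective_param y

/-- `param ∘ paramInv = id` on the image of `param`. [folklore] -/
theorem param_paramInv {x : 𝔼 2} (hx : x ∈ range T.param) : T.param (T.paramInv x) = x :=
  Function.invFun_eq hx

/-- The inverse of the parametrisation is smooth on the image. [folklore] -/
theorem contDiffOn_paramInv : ContDiffOn ℝ ∞ T.paramInv (range T.param) :=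
  T.contDiffOn_invFun_param

/-- The **pull-back** `param⁻¹ ∘ g ∘ param` of a self-map `g` of the plane preserving the image of
the parametrisation. [folklore] -/
def pull (g : 𝔼 2 → 𝔼 2) : 𝔼 2 → 𝔼 2 := T.paramInv ∘ g ∘ T.param

/-- Unfolding of `pull`. [folklore] -/
theorem pull_apply (g : 𝔼 2 → 𝔼 2) (y : 𝔼 2) : T.pull g y = T.paramInv (g (T.param y)) := rfl

/-- `param ∘ pull g = g ∘ param` when `g` preserves the image of `param`. [folklore] -/
theorem param_pull {g : 𝔼 2 → 𝔼 2} (hg : ∀ x ∈ range T.param, g x ∈ range T.param) (y : 𝔼 2) :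
    T.param (T.pull g y) = g (T.param y) :=
  T.param_paramInv (hg _ (mem_range_self y))

/-- Pull-backs compose. [folklore] -/
theorem pull_pull {g g' : 𝔼 2 → 𝔼 2} (hg : ∀ x ∈ range T.param, g x ∈ range T.param) (y : 𝔼 2) :
    T.pull g' (T.pull g y) = T.pull (g' ∘ g) y := by
  simp only [pull_apply, comp_apply]
  rw [T.param_paramInv (hg _ (mem_range_self y))]

/-- The pull-back of the identity is the identity. [folklore] -/
@[simp]
theorem pull_id : T.pull id = id :=
  funext fun y ↦ by rw [pull_apply, id, paramInv_param, id]

/-- The pull-back of a map fixing `param y` fixes `y`. [folklore] -/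
theorem pull_eq_self {g : 𝔼 2 → 𝔼 2} {y : 𝔼 2} (hg : g (T.param y) = T.param y) : T.pull g y = y := by
  rw [pull_apply, hg, paramInv_param]

/-! ### Lifting a planar diffeotopy to a compactly supported diffeotopy of `ℝ³` -/

/-- The cut-off in the third coordinate: a bump function on `ℝ¹`, `1` on `B̄(0, z₀/2)`, `0` off
`B(0, z₀)`. [folklore] -/
def zCut {z₀ : ℝ} (hz₀ : 0 < z₀) : ContDiffBump (0 : 𝔼 1) :=
  ⟨z₀ / 2, z₀, by positivity, by linarith⟩

/-- The cut-off is `1` at the origin. [folklore] -/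
theorem zCut_zero {z₀ : ℝ} (hz₀ : 0 < z₀) : (zCut hz₀ : 𝔼 1 → ℝ) 0 = 1 :=
  (zCut hz₀).one_of_mem_closedBall (mem_closedBall_self (zCut hz₀).rIn_pos.le)

/-- The cut-off vanishes off `B(0, z₀)`. [folklore] -/
theorem zCut_eq_zero {z₀ : ℝ} (hz₀ : 0 < z₀) {z : 𝔼 1} (hz : z₀ ≤ ‖z‖) : (zCut hz₀ : 𝔼 1 → ℝ) z = 0 :=
  (zCut hz₀).zero_of_le_dist (by simpa [zCut] using hz)

variable {h : Diffeotopy 𝓘(ℝ, 𝔼 2) (𝔼 2)} {C : Set (𝔼 2)} {z₀ : ℝ}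

/-- The stages of the **lift** of a planar diffeotopy `h` to `ℝ³ = ℝ² × ℝ¹`: over the fibre point
`z`, the plane is moved by the pull-back of the stage `h_{t κ(z)}`, `κ = zCut` (so the plane
`z = 0` moves by the pull-back of `h_t`, and nothing moves for `‖z‖ ≥ z₀`). [folklore] -/
def liftFun (hz₀ : 0 < z₀) (t : ℝ) (v : 𝔼 3) : 𝔼 3 :=
  slabEquiv.symm (T.pull (h.toFun (t * (zCut hz₀ : 𝔼 1 → ℝ) (slabEquiv v).2)) (slabEquiv v).1, (slabEquiv v).2)

/-- The inverse stages of the lift. [folklore] -/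
def liftInv (hz₀ : 0 < z₀) (t : ℝ) (v : 𝔼 3) : 𝔼 3 :=
  slabEquiv.symm (T.pull (h.invFun (t * (zCut hz₀ : 𝔼 1 → ℝ) (slabEquiv v).2)) (slabEquiv v).1, (slabEquiv v).2)

/-- The lift on slab coordinates. [folklore] -/
theorem liftFun_symm_apply (hz₀ : 0 < z₀) (t : ℝ) (y : 𝔼 2) (z : 𝔼 1) :
    T.liftFun (h := h) hz₀ t (slabEquiv.symm (y, z)) =
      slabEquiv.symm (T.pull (h.toFun (t * (zCut hz₀ : 𝔼 1 → ℝ) z)) y, z) := by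
  simp [liftFun]

/-- On the coordinate plane the lift is the pull-back of the stage `h_t`. [folklore] -/
theorem liftFun_inl (hz₀ : 0 < z₀) (t : ℝ) (y : 𝔼 2) :
    T.liftFun (h := h) hz₀ t (slabEquiv.symm (y, 0)) = slabEquiv.symm (T.pull (h.toFun t) y, 0) := by
  rw [liftFun_symm_apply, zCut_zero, mul_one]

/-- If the stages of `h` are the identity off `C ⊆ range param`, every stage of `h` and of `h⁻¹`
preserves the image of `param`. [folklore] -/
theorem mapsTo_of_support (hCσ : C ⊆ range T.param) (hh : ∀ s, ∀ x ∉ C, h.toFun s x = x) (s : ℝ) :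
    (∀ x ∈ range T.param, h.toFun s x ∈ range T.param) ∧
      ∀ x ∈ range T.param, h.invFun s x ∈ range T.param := by
  have hinv : ∀ x ∉ C, h.invFun s x = x := fun x hx ↦ by
    conv_lhs => rw [← hh s x hx]
    exact h.invFun_toFun s x
  exact ⟨fun x hx ↦ mem_of_apply_of_subset (h.stage s).injective (hh s) hCσ hx,
    fun x hx ↦ mem_of_apply_of_subset (h.stage s).symm.injective hinv hCσ hx⟩

/-- Joint smoothness of `(s, y) ↦ pull (F s) y` for a jointly smooth planar family `F` preserving
the image of `param`. [folklore] -/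
theorem contDiff_pull_family {F : ℝ → 𝔼 2 → 𝔼 2} (hF : ContDiff ℝ ∞ (uncurry F))
    (hFσ : ∀ s, ∀ x ∈ range T.param, F s x ∈ range T.param) :
    ContDiff ℝ ∞ fun p : ℝ × 𝔼 2 ↦ T.pull (F p.1) p.2 := by
  have h1 : ContDiff ℝ ∞ fun p : ℝ × 𝔼 2 ↦ F p.1 (T.param p.2) :=
    hF.comp (contDiff_fst.prodMk (T.contDiff_param.comp contDiff_snd))
  exact T.contDiffOn_paramInv.comp_contDiff h1 fun p ↦ hFσ _ _ (mem_range_self _)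

/-- Joint smoothness of the lift of a jointly smooth planar family preserving the image of
`param`. [folklore] -/
theorem contDiff_lift_family (hz₀ : 0 < z₀) {F : ℝ → 𝔼 2 → 𝔼 2} (hF : ContDiff ℝ ∞ (uncurry F))
    (hFσ : ∀ s, ∀ x ∈ range T.param, F s x ∈ range T.param) :
    ContDiff ℝ ∞ (uncurry fun (t : ℝ) (v : 𝔼 3) ↦
      slabEquiv.symm (T.pull (F (t * (zCut hz₀ : 𝔼 1 → ℝ) (slabEquiv v).2)) (slabEquiv v).1, (slabEquiv v).2)) := by
  have hy : ContDiff ℝ ∞ fun p : ℝ × 𝔼 3 ↦ (slabEquiv p.2).1 := contDiff_fst.comp (slabEquiv.contDiff.comp contDiff_snd)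
  have hz : ContDiff ℝ ∞ fun p : ℝ × 𝔼 3 ↦ (slabEquiv p.2).2 := contDiff_snd.comp (slabEquiv.contDiff.comp contDiff_snd)
  have hs : ContDiff ℝ ∞ fun p : ℝ × 𝔼 3 ↦ p.1 * (zCut hz₀ : 𝔼 1 → ℝ) (slabEquiv p.2).2 :=
    contDiff_fst.mul ((zCut hz₀).contDiff.comp hz)
  have hp := (T.contDiff_pull_family hF hFσ).comp (hs.prodMk hy)
  exact slabEquiv.symm.contDiff.comp (hp.prodMk hz)

/-- **The lift of a planar diffeotopy** with stages the identity off a compact `C ⊆ range param`: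
a diffeotopy of `ℝ³` (`Diffeotopy.mk'` from `liftFun` and `liftInv`). [folklore] -/
def lift (hz₀ : 0 < z₀) (hCσ : C ⊆ range T.param) (hh : ∀ s, ∀ x ∉ C, h.toFun s x = x) :
    Diffeotopy 𝓘(ℝ, 𝔼 3) (𝔼 3) :=
  Diffeotopy.mk' 𝓘(ℝ, 𝔼 3) (T.liftFun hz₀) (T.liftInv hz₀)
    (contMDiff_prod_self_of_contDiff
      (T.contDiff_lift_family hz₀ h.contDiff_uncurry_toFun fun s ↦ (T.mapsTo_of_support hCσ hh s).1))
    (contMDiff_prod_self_of_contDiff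
      (T.contDiff_lift_family hz₀ h.contDiff_uncurry_invFun fun s ↦ (T.mapsTo_of_support hCσ hh s).2))
    (fun t v ↦ by
      simp only [liftFun, liftInv, ContinuousLinearEquiv.apply_symm_apply]
      rw [T.pull_pull (T.mapsTo_of_support hCσ hh _).1]
      conv_rhs => rw [← slabEquiv.symm_apply_apply v]
      congr 2
      exact T.pull_eq_self (h.invFun_toFun _ _))
    (fun t v ↦ by
      simp only [liftFun, liftInv, ContinuousLinearEquiv.apply_symm_apply]
      rw [T.pull_pull (T.mapsTo_of_support hCσ hh _).2]
      conv_rhs => rw [← slabEquiv.symm_apply_apply v]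
      congr 2
      exact T.pull_eq_self (h.toFun_invFun _ _))
    (funext fun v ↦ by simp [liftFun, zero_mul, h.toFun_zero])

/-- Stages of the lift (definitional). [folklore] -/
@[simp]
theorem lift_toFun (hz₀ : 0 < z₀) (hCσ : C ⊆ range T.param) (hh : ∀ s, ∀ x ∉ C, h.toFun s x = x) :
    (T.lift hz₀ hCσ hh).toFun = T.liftFun (h := h) hz₀ := rfl

/-- **The lift only moves points of the slab over `param⁻¹(C)` of height `< z₀`**: if
`param y ∉ C` or `z₀ ≤ ‖z‖` then `(y, z)` is fixed by every stage. [folklore] -/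
theorem liftFun_eq_self (hz₀ : 0 < z₀) (hh : ∀ s, ∀ x ∉ C, h.toFun s x = x) (t : ℝ) {y : 𝔼 2} {z : 𝔼 1}
    (hyz : T.param y ∉ C ∨ z₀ ≤ ‖z‖) : T.liftFun (h := h) hz₀ t (slabEquiv.symm (y, z)) = slabEquiv.symm (y, z) := by
  rw [liftFun_symm_apply]
  congr 2
  rcases hyz with hy | hz
  · exact T.pull_eq_self (hh _ _ hy)
  · rw [zCut_eq_zero hz₀ hz, mul_zero, h.toFun_zero]
    exact T.pull_eq_self rfl

/-- **The lift is compactly supported**: its stages are the identity off one ball of `ℝ³`.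
[folklore] -/
theorem exists_liftFun_eq_self (hz₀ : 0 < z₀) (hC : IsCompact C) (hCσ : C ⊆ range T.param)
    (hh : ∀ s, ∀ x ∉ C, h.toFun s x = x) :
    ∃ R : ℝ, ∀ t v, R ≤ ‖v‖ → T.liftFun (h := h) hz₀ t v = v := by
  -- the moved set lies in the image of the compact `paramInv '' C × B̄(0, z₀)`
  have hK : IsCompact (slabEquiv.symm '' ((T.paramInv '' C) ×ˢ closedBall (0 : 𝔼 1) z₀)) :=
    (((hC.image_of_continuousOn (T.contDiffOn_paramInv.continuousOn.mono hCσ))).prod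
      (isCompact_closedBall _ _)).image slabEquiv.symm.continuous
  obtain ⟨R, hR⟩ := hK.isBounded.subset_ball 0
  refine ⟨R, fun t v hv ↦ ?_⟩
  have hv' : v ∉ slabEquiv.symm '' ((T.paramInv '' C) ×ˢ closedBall (0 : 𝔼 1) z₀) := fun hmem ↦ by
    have := hR hmem
    rw [mem_ball_zero_iff] at this
    linarith
  obtain ⟨⟨y, z⟩, rfl⟩ : ∃ q : (𝔼 2) × 𝔼 1, slabEquiv.symm q = v := ⟨slabEquiv v, slabEquiv.symm_apply_apply v⟩
  refine T.liftFun_eq_self hz₀ hh t ?_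
  by_contra hcon
  rw [not_or, not_not, not_le] at hcon
  refine hv' ⟨(y, z), ⟨?_, mem_closedBall_zero_iff.2 hcon.2.le⟩, rfl⟩
  exact ⟨T.param y, hcon.1, T.paramInv_param y⟩

/-! ### The transported ambient isotopy of `𝕊³` -/

/-- **Transport of a planar diffeotopy to `𝕊³` along a thickening.** For a planar diffeotopy `h`
whose stages are the identity off a compact `C ⊆ range param` and a height `z₀ > 0`, the lift
of `h` to `ℝ³` is compactly supported, so its transport along the chart `T.chart`
(`Diffeotopy.chartTransport`, extension by the identity off the image of the thickening) is a
diffeotopy of `𝕊³`. Hirsch (1976), Ch. 8 §1 (isotopies with compact support extend by the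
identity). [folklore] -/
def transport (hz₀ : 0 < z₀) (hC : IsCompact C) (hCσ : C ⊆ range T.param)
    (hh : ∀ s, ∀ x ∉ C, h.toFun s x = x) : Diffeotopy 𝓘(ℝ, 𝔼 3) (𝕊 3) :=
  (T.lift hz₀ hCσ hh).chartTransport T.contMDiffOn_chart T.contMDiff_chart_symm T.chart_target
    (R := (T.exists_liftFun_eq_self hz₀ hC hCσ hh).choose)
    (T.exists_liftFun_eq_self hz₀ hC hCσ hh).choose_spec

/-- **The transported diffeotopy intertwines the thickening with the lift**:
`F_t (emb v) = emb (lift_t v)`. [folklore] -/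
theorem transport_apply_emb (hz₀ : 0 < z₀) (hC : IsCompact C) (hCσ : C ⊆ range T.param)
    (hh : ∀ s, ∀ x ∉ C, h.toFun s x = x) (t : ℝ) (v : 𝔼 3) :
    (T.transport hz₀ hC hCσ hh).toFun t (T.emb v) = T.emb (T.liftFun (h := h) hz₀ t v) := by
  rw [transport, Diffeotopy.chartTransport_toFun, ← coe_chart_symm, chartTransport_symm_apply T.chart_target]
  rfl

/-- **The transported diffeotopy is the identity off the image of the thickening.** [folklore] -/
theorem transport_apply_of_not_mem (hz₀ : 0 < z₀) (hC : IsCompact C) (hCσ : C ⊆ range T.param)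
    (hh : ∀ s, ∀ x ∉ C, h.toFun s x = x) (t : ℝ) {w : 𝕊 3} (hw : w ∉ range T.emb) :
    (T.transport hz₀ hC hCσ hh).toFun t w = w := by
  rw [transport, Diffeotopy.chartTransport_toFun]
  exact chartTransport_of_not_mem _ (by rwa [chart_source])

/-- **On the band surface the transported diffeotopy is the planar diffeotopy**:
`F_t (β x) = β (h_t x)` for `x` in the image of the parametrisation. [folklore] -/
theorem transport_apply_patch (hz₀ : 0 < z₀) (hC : IsCompact C) (hCσ : C ⊆ range T.param)
    (hh : ∀ s, ∀ x ∉ C, h.toFun s x = x) (t : ℝ) {x : 𝔼 2} (hx : x ∈ range T.param) :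
    (T.transport hz₀ hC hCσ hh).toFun t (β x) = β (h.toFun t x) := by
  obtain ⟨y, rfl⟩ := hx
  rw [← T.emb_inl, transport_apply_emb, liftFun_inl, T.emb_inl,
    T.param_pull (T.mapsTo_of_support hCσ hh t).1]

/-- **Support of the transported diffeotopy**: a point of `𝕊³` is moved at time `t` only if it is
`emb (y, z)` with `param y ∈ C` and `‖z‖ < z₀`. [folklore] -/
theorem transport_apply_eq_self (hz₀ : 0 < z₀) (hC : IsCompact C) (hCσ : C ⊆ range T.param)
    (hh : ∀ s, ∀ x ∉ C, h.toFun s x = x) (t : ℝ) {w : 𝕊 3}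
    (hw : ∀ (y : 𝔼 2) (z : 𝔼 1), w = T.emb (slabEquiv.symm (y, z)) → T.param y ∉ C ∨ z₀ ≤ ‖z‖) :
    (T.transport hz₀ hC hCσ hh).toFun t w = w := by
  by_cases hmem : w ∈ range T.emb
  · obtain ⟨v, rfl⟩ := hmem
    obtain ⟨⟨y, z⟩, rfl⟩ : ∃ q : (𝔼 2) × 𝔼 1, slabEquiv.symm q = v := ⟨slabEquiv v, slabEquiv.symm_apply_apply v⟩
    rw [transport_apply_emb, T.liftFun_eq_self hz₀ hh t (hw y z rfl)]
  · exact T.transport_apply_of_not_mem hz₀ hC hCσ hh t hmem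

end PatchThickening


/-! ## Regular band data admit thickenings -/

namespace BandData

variable {K₁ K₂ K : Knot} {avoid : Set (𝕊 3)}

/-- **A regular band thickens**: for regular band data (`BandData.IsRegular`: the band map is an
injective immersion on a collar `squareNhd δ₀`, `δ₀ > δ`) there is a thickening of the band over
the intermediate collar square of width `δ₁ = (δ + δ₀)/2` (`nonempty_patchThickening`,
`BandThickening.lean`; Hirsch (1976), Ch. 4 §5, tubular neighbourhood of the embedded closed
rectangle). [cite: HirschDT1976, Ch. 4 §5 Thms. 5.1–5.2] -/
theorem IsRegular.exists_patchThickening {b : BandData K₁ K₂ K avoid} (h : b.IsRegular) :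
    ∃ δ₀ δ₁ : ℝ, b.δ < δ₁ ∧ δ₁ < δ₀ ∧ Nonempty (PatchThickening b.band δ₀ δ₁) := by
  obtain ⟨δ₀, hδ₀, hinj, himm⟩ := h
  have hδ := b.δ_pos
  exact ⟨δ₀, (b.δ + δ₀) / 2, by linarith, by linarith,
    nonempty_patchThickening b.contMDiff (by linarith) (by linarith) hinj himm⟩

end BandData

end Literature.Topology.FourManifolds
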